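import Summits.CriticalPhenomena.CardyFormulaZ2.Theorems.CardyComplexConeParafermionToSLESixFamiliesDiamondDartPhaseLocal
import HarnessLib

/-!
# The straight staircase of a side of a lattice box is a path of out-edges
# (line `potential-darboux-picard-diamond`, S1p `stub_boundaryDartPhase`, part 13)

Crux `ParafermionToSLESixFamilies` (stmt-CriticalPhenomena-11389), line `potential-darboux-picard-diamond`, stub
`stub_boundaryDartPhase` (S1p). The lattice points of an open marked diamond form a BOX in the four layer coordinates
`X_j = xiC j - upC j` of the frame (`X_j ≤ M j` for the four sides `j`; `diamondArcs_exists_box` of S1c in the coordinates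
`x₀ + x₁`, `x₁ - x₀`, `genBox_iff`). In the frame of side `k` (`X = X_k`, tangential coordinate `T = xiC k + upC k = X_{k+1}`)
the STAIRCASE of the side is the zigzag `stair k x n = x + ⌊n/2⌋ (u_k + u_{k+1}) + (n mod 2) u_k` (`n : ℤ`) through the
inner layer `X = M k - 1` (even `n`) and the outer layer `X = M k` (odd `n`), the tangential coordinate increasing by one
per step (`xiC_stair`, `upC_stair`, `stair_succ`). For data on a convex domain with these lattice points, read at a mesh
where every lattice point of the domain is in `Ω_δ`, every step of the staircase whose tangential coordinate stays two
units inside the box is an OUT-EDGE — the face on its left is inner, the face on its right is not (`stair_outEdge`,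
registered as `stair_outEdge_path`): the staircase runs counter-clockwise with the domain on its left, from ANY inner
site of the side, corners of the diamond included (moving away from the corner). This is the lattice input of the
position of the start edge (`forall_mem_zdArcB_of_outPath`).
-/

noncomputable section

namespace Summit.CriticalPhenomena.CardyFormulaZ2.Cruxes.ParafermionToSLESixFamilies.PotentialDarbouxPicardDiamond

open Set Metric Complex
open Literature.Probability Literature.Probability.LatticeModels Literature.Probability.Percolation
open Literature.Probability.LatticeModels.DiscreteDobrushin
open Literature.Probability.RandomPlanarGeometry

/-! ## The four layer coordinates in the frame of one side -/

/-- The layer coordinate of the next side is the tangential coordinate. -/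
theorem X_succ (k : Fin 4) (x : Site 2) : xiC (k + 1) x - upC (k + 1) x = xiC k x + upC k x := by
  fin_cases k <;> simp [xiC, upC] <;> ring

/-- The layer coordinate of the opposite side. -/
theorem X_add_two (k : Fin 4) (x : Site 2) : xiC (k + 2) x - upC (k + 2) x = -(xiC k x - upC k x) := by
  fin_cases k <;> simp [xiC, upC] <;> ring

/-- The layer coordinate of the previous side. -/
theorem X_add_three (k : Fin 4) (x : Site 2) : xiC (k + 3) x - upC (k + 3) x = -(xiC k x + upC k x) := by
  fin_cases k <;> simp [xiC, upC] <;> ring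

/-- **The box in the frame of side `k`.** -/
theorem box_iff_side (M : Fin 4 → ℤ) (k : Fin 4) (x : Site 2) :
    (∀ j : Fin 4, xiC j x - upC j x ≤ M j) ↔
      (xiC k x - upC k x ≤ M k ∧ xiC k x + upC k x ≤ M (k + 1) ∧ -M (k + 2) ≤ xiC k x - upC k x ∧ -M (k + 3) ≤ xiC k x + upC k x) := by
  constructor
  · intro h
    have h0 := h k
    have h1 := h (k + 1)
    have h2 := h (k + 2)
    have h3 := h (k + 3)
    rw [X_succ] at h1
    rw [X_add_two] at h2
    rw [X_add_three] at h3
    exact ⟨h0, h1, by linarith, by linarith⟩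
  · rintro ⟨h0, h1, h2, h3⟩ j
    obtain ⟨m, rfl⟩ := exists_eq_add k j
    fin_cases m
    · simpa using h0
    · simp only [Fin.mk_one]; rw [X_succ]; exact h1
    · simp only [Fin.reduceFinMk]; rw [X_add_two]; linarith
    · simp only [Fin.reduceFinMk]; rw [X_add_three]; linarith

/-- **The box of S1c in the four layer coordinates**: `a ≤ x₀ + x₁ ≤ b, a' ≤ x₁ - x₀ ≤ b'` is `X_j ≤ M j` with
`M = (-a', b, b', -a)`. -/
theorem genBox_iff (a b a' b' : ℤ) (x : Site 2) :
    (a ≤ x 0 + x 1 ∧ x 0 + x 1 ≤ b ∧ a' ≤ x 1 - x 0 ∧ x 1 - x 0 ≤ b') ↔ ∀ j : Fin 4, xiC j x - upC j x ≤ (![-a', b, b', -a] : Fin 4 → ℤ) j := by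
  constructor
  · intro h j
    fin_cases j <;> simp [xiC, upC] <;> omega
  · intro h
    have h0 := h 0; have h1 := h 1; have h2 := h 2; have h3 := h 3
    simp [xiC, upC] at h0 h1 h2 h3
    omega

/-! ## The staircase -/

/-- The STAIRCASE of side `k` from `x`: `x + ⌊n/2⌋ (u_k + u_{k+1}) + (n mod 2) u_k`. -/
def stair (k : Fin 4) (x : Site 2) (n : ℤ) : Site 2 :=
  x + (n / 2) • cornerUnit k + (n / 2) • cornerUnit (k + 1) + (n % 2) • cornerUnit k

/-- The normal lattice coordinate along the staircase. -/
@[simp] theorem xiC_stair (k : Fin 4) (x : Site 2) (n : ℤ) : xiC k (stair k x n) = xiC k x + n / 2 + n % 2 := by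
  simp only [stair, xiC_add_smul0, xiC_add_smul1]

/-- The second lattice coordinate along the staircase. -/
@[simp] theorem upC_stair (k : Fin 4) (x : Site 2) (n : ℤ) : upC k (stair k x n) = upC k x + n / 2 := by
  simp only [stair, upC_add_smul0, upC_add_smul1]

/-- The staircase starts at `x`. -/
@[simp] theorem stair_zero (k : Fin 4) (x : Site 2) : stair k x 0 = x := by
  simp only [stair, Int.zero_ediv, zero_smul, add_zero, Int.zero_emod]

/-- **One step of the staircase**: `u_k` from the inner layer (even `n`), `u_{k+1}` from the outer layer (odd `n`). -/
theorem stair_succ (k : Fin 4) (x : Site 2) (n : ℤ) :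
    stair k x (n + 1) = stair k x n + cornerUnit (if n % 2 = 0 then k else k + 1) := by
  rcases Int.emod_two_eq_zero_or_one n with h | h
  · rw [if_pos h]
    apply eq_of_xiC_upC (k := k)
    · simp only [xiC_stair, xiC_add_unit0]; omega
    · simp only [upC_stair, upC_add_unit0]; omega
  · rw [if_neg (by omega)]
    apply eq_of_xiC_upC (k := k)
    · simp only [xiC_stair, xiC_add_unit1]; omega
    · simp only [upC_stair, upC_add_unit1]; omega

/-- The tangential coordinate increases by one per step: the staircase does not repeat a site. -/
theorem stair_injective (k : Fin 4) (x : Site 2) : Function.Injective (stair k x) := by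
  intro n m h
  have h1 := congrArg (fun v => xiC k v + upC k v) h
  simp only [xiC_stair, upC_stair] at h1
  omega

/-! ## Out-edges of a box datum in the frame of side `k` -/

section Box

variable {Ω : Set ℂ} (hconv : Convex ℝ Ω) {δ : ℝ} (hgood : ∀ x : Site 2, meshPoint δ x ∈ Ω → x ∈ meshDomain Ω δ)
  {E : DiscreteDobrushin} (hΩ : E.Ω = Ω) (hEδ : E.δ = δ) {M : Fin 4 → ℤ}
  (hbox : ∀ x : Site 2, meshPoint δ x ∈ Ω ↔ ∀ j : Fin 4, xiC j x - upC j x ≤ M j) (k : Fin 4)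

include hbox in
/-- Box membership in the frame of side `k`. -/
theorem mem_iff_side (x : Site 2) : meshPoint δ x ∈ Ω ↔
    (xiC k x - upC k x ≤ M k ∧ xiC k x + upC k x ≤ M (k + 1) ∧ -M (k + 2) ≤ xiC k x - upC k x ∧ -M (k + 3) ≤ xiC k x + upC k x) := by
  rw [hbox, box_iff_side]

include hconv hgood hΩ hEδ hbox in
/-- **The step `u_k` from an inner-layer site is an out-edge**: the face between `u_k` and `u_{k+1}` is inner, the face
between `u_{k+3}` and `u_k` has its far corner two layers out. -/
theorem isOutEdge_inner {v : Site 2} (hX1 : xiC k v - upC k v + 1 ≤ M k) (hX2 : M k < xiC k v - upC k v + 2)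
    (hX3 : -M (k + 2) ≤ xiC k v - upC k v - 1) (hT1 : -M (k + 3) ≤ xiC k v + upC k v) (hT2 : xiC k v + upC k v + 2 ≤ M (k + 1)) :
    E.IsOutEdge v k := by
  constructor
  · refine isInnerFace_of_forall_corner_mem hconv hgood hΩ hEδ fun w hw => ?_
    rw [mem_iff_side hbox k]
    rcases corner_faceAt_cases hw with rfl | rfl | rfl | rfl
    · omega
    · simp only [xiC_add_unit0, upC_add_unit0]; omega
    · simp only [xiC_add_unit1, upC_add_unit1]; omega
    · simp only [xiC_add_unit0, upC_add_unit0, xiC_add_unit1, upC_add_unit1]; omega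
  · rw [faceAt_wired₁]
    refine not_isInnerFace_of_corner_not_mem (isCorner_faceAt _ _) ?_
    rw [hΩ, hEδ, mem_iff_side hbox k]
    simp only [xiC_add_unit0, upC_add_unit0, xiC_add_unit3, upC_add_unit3]
    omega

include hconv hgood hΩ hEδ hbox in
/-- **The step `u_{k+1}` from an outer-layer site is an out-edge**: the face between `u_{k+1}` and `u_{k+2}` is inner,
the face between `u_k` and `u_{k+1}` has the corner `v + u_k` one layer out. -/
theorem isOutEdge_outer {w : Site 2} (hX0 : xiC k w - upC k w = M k) (hX3 : -M (k + 2) ≤ xiC k w - upC k w - 2)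
    (hT1 : -M (k + 3) ≤ xiC k w + upC k w - 1) (hT2 : xiC k w + upC k w + 1 ≤ M (k + 1)) :
    E.IsOutEdge w (k + 1) := by
  constructor
  · refine isInnerFace_of_forall_corner_mem hconv hgood hΩ hEδ fun u hu => ?_
    rw [mem_iff_side hbox k]
    have e : k + 1 + 1 = k + 2 := by abel
    rcases corner_faceAt_cases hu with rfl | rfl | rfl | rfl
    · omega
    · simp only [xiC_add_unit1, upC_add_unit1]; omega
    · simp only [e, xiC_add_unit2, upC_add_unit2]; omega
    · simp only [e, xiC_add_unit1, upC_add_unit1, xiC_add_unit2, upC_add_unit2]; omega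
  · rw [fin4_add_one_add_three]
    refine not_isInnerFace_of_corner_not_mem ((isCorner_add_faceAt_iff w k k).2 (Or.inl rfl)) ?_
    rw [hΩ, hEδ, mem_iff_side hbox k]
    simp only [xiC_add_unit0, upC_add_unit0]
    omega

include hconv hgood hΩ hEδ hbox in
/-- **Every step of the staircase from an inner site is an out-edge**, as long as the tangential coordinate stays inside
the box — one unit more on the outer layer behind, two units ahead from the inner layer and one from the outer layer (and
the box is at least two layers wide across side `k`). -/
theorem stair_outEdge {x : Site 2} (hX : xiC k x - upC k x = M k - 1) (hw : 2 ≤ M k + M (k + 2)) {n : ℤ}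
    (hT1 : -M (k + 3) + n % 2 ≤ xiC k x + upC k x + n) (hT2 : xiC k x + upC k x + n + 2 - n % 2 ≤ M (k + 1)) :
    E.IsOutEdge (stair k x n) (if n % 2 = 0 then k else k + 1) ∧
      stair k x (n + 1) = stair k x n + cornerUnit (if n % 2 = 0 then k else k + 1) := by
  refine ⟨?_, stair_succ k x n⟩
  rcases Int.emod_two_eq_zero_or_one n with h | h
  · rw [if_pos h]
    rw [h] at hT1 hT2
    refine isOutEdge_inner hconv hgood hΩ hEδ hbox k ?_ ?_ ?_ ?_ ?_ <;> simp only [xiC_stair, upC_stair] <;> omega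
  · rw [if_neg (by omega)]
    rw [h] at hT1 hT2
    refine isOutEdge_outer hconv hgood hΩ hEδ hbox k ?_ ?_ ?_ ?_ <;> simp only [xiC_stair, upC_stair] <;> omega

include hbox in
/-- The staircase stays inside the box (under the same conditions). -/
theorem stair_mem {x : Site 2} (hX : xiC k x - upC k x = M k - 1) (hw : 2 ≤ M k + M (k + 2)) {n : ℤ}
    (hT1 : -M (k + 3) ≤ xiC k x + upC k x + n) (hT2 : xiC k x + upC k x + n ≤ M (k + 1)) : meshPoint δ (stair k x n) ∈ Ω := by
  rw [mem_iff_side hbox k]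
  simp only [xiC_stair, upC_stair]
  omega

end Box

/-- **The staircase of a side is a path of out-edges** (registered helper of `stub_boundaryDartPhase`): forward (indices
`n₀, n₀ + 1, …, n₀ + L`: an out-edge path) and backward (`n₀, n₀ - 1, …, n₀ - L`: an in-edge path), with the
interface of `forall_mem_zdArcB_of_outPath` / `forall_mem_zdArcA_of_inPath`. -/
theorem stair_outEdge_path : ∀ (Ω : Set ℂ), Convex ℝ Ω → ∀ (δ : ℝ), (∀ x : Site 2, meshPoint δ x ∈ Ω → x ∈ meshDomain Ω δ) → ∀ (E : DiscreteDobrushin), E.Ω = Ω → E.δ = δ → ∀ (M : Fin 4 → ℤ), (∀ x : Site 2, meshPoint δ x ∈ Ω ↔ ∀ j : Fin 4, xiC j x - upC j x ≤ M j) → ∀ (k : Fin 4) (x : Site 2), xiC k x - upC k x = M k - 1 → 2 ≤ M k + M (k + 2) → ∀ (n₀ : ℤ) (L : ℕ), ((-M (k + 3) + 1 ≤ xiC k x + upC k x + n₀ → xiC k x + upC k x + n₀ + L + 2 ≤ M (k + 1) → (∀ i : ℕ, i < L → ∃ d : Fin 4, stair k x (n₀ + (i + 1 : ℕ)) = stair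 k x (n₀ + i) + cornerUnit d ∧ E.IsOutEdge (stair k x (n₀ + i)) d) ∧ (∀ i j : ℕ, i ≤ L → j ≤ L → stair k x (n₀ + i) = stair k x (n₀ + j) → i = j)) ∧ (-M (k + 3) + 1 + L ≤ xiC k x + upC k x + n₀ → xiC k x + upC k x + n₀ + 2 ≤ M (k + 1) → (∀ i : ℕ, i < L → ∃ d : Fin 4, stair k x (n₀ - (i + 1 : ℕ)) = stair k x (n₀ - i) + cornerUnit d ∧ E.IsOutEdge (stair k x (n₀ - (i + 1 : ℕ))) (d + 2)) ∧ (∀ i j : ℕ, i ≤ L → j ≤ L → stair k x (n₀ - i) = stair k x (n₀ - j) → i = j))) := by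
  intro Ω hconv δ hgood E hΩ hEδ M hbox k x hX hw n₀ L
  have hinj := stair_injective k x
  refine ⟨fun hT1 hT2 => ⟨fun i hi => ?_, fun i j _ _ h => ?_⟩, fun hT1 hT2 => ⟨fun i hi => ?_, fun i j _ _ h => ?_⟩⟩
  · obtain ⟨hout, hstep⟩ := stair_outEdge hconv hgood hΩ hEδ hbox k hX hw (n := n₀ + i) (by omega) (by omega)
    refine ⟨_, ?_, hout⟩
    rw [← hstep]; congr 1; push_cast; ring
  · have := hinj h; omega
  · obtain ⟨hout, hstep⟩ := stair_outEdge hconv hgood hΩ hEδ hbox k hX hw (n := n₀ - (i + 1 : ℕ)) (by push_cast; omega)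
      (by push_cast; omega)
    have e : n₀ - ((i + 1 : ℕ) : ℤ) + 1 = n₀ - i := by push_cast; ring
    rw [e] at hstep
    refine ⟨(if (n₀ - ((i + 1 : ℕ) : ℤ)) % 2 = 0 then k else k + 1) + 2, ?_, ?_⟩
    · rw [hstep, add_assoc, cornerUnit_add_two, add_neg_cancel, add_zero]
    · rw [fin4_add_two_add_two']; exact hout
  · have := hinj h; omega

end Summit.CriticalPhenomena.CardyFormulaZ2.Cruxes.ParafermionToSLESixFamilies.PotentialDarbouxPicardDiamond

end
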